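import Summits.NavierStokesRegularity.NavierStokesRegularity.Theorems.TypeIliouvilleNoTypeII.Negative.NSIAncientCascade
import HarnessLib

/-!
# The ancient Euler-self-similar NSI cascade, II: scale-invariant ball bounds and power gauges

Negative-lane support file for `stmt-NavierStokesRegularity-0056` (kill-kit, model class M2′),
bearing on the crux `PowerGaugeEulerLiouville` (item 19832) of the §B route `EulerZoomLiouville`.
For the ancient zoom-out `𝔘` of the super-similar NSI cascade on Seregin's Euler line
`a = τ^{-(1+ρ)}` (`NSIAncientCascade`: characterised by its window property), the three
scale-invariant ball bounds are transported from those of `𝔲` window by window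
(`ancient_lintegral_ball_norm_sq_le`: `∫_{B_r}|𝔘(s)|² ≤ C r^{1-2ρ}` for every `s`;
`ancient_lintegral_cylinder_frobeniusNormSq_le`: `∫∫_{ℝ×B_r}|D𝔘|² ≤ C r^{1-ρ}`;
`ancient_lintegral_cylinder_pressure_le`: `∫∫_{ℝ×B_r}|p̃[𝔘]|^{3/2} ≤ C r^{2-2ρ}`; monotone
convergence over the increasing windows and the Euler change of variables, whose Jacobian the
bounds absorb exactly: `window_scaling_A/E/D`), whence Seregin's power gauges
`r^{2ρ}A + r^{ρ}E + r^{2ρ}D ≤ M` for `𝔘` at EVERY centre and EVERY scale `r > 0`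
(`ancient_powerGauges_le`; hypothesis (1.7) of the crux at `z₀ = 0` for all `a > 0`:
`ancient_powerGauges_le_nnreal`). WHAT THIS IS NOT: nothing about NS/Euler solutions.

References: Seregin, arXiv:2402.13229 (2024), (1.7); Ożański, arXiv:1709.00602 (2017), §2
[`Ozanski2017NSISingular`]; CKN 1982, §2 (scaling).
-/

noncomputable section

open MeasureTheory Set Function Filter Topology Metric Module
open scoped ENNReal NNReal

set_option linter.dupNamespace false

namespace Summit.NavierStokesRegularity.NavierStokesRegularity.Theorems.TypeIliouvilleNoTypeIINegative

open Literature.Analysis.FluidPDE Literature.Barriers.NavierStokesRegularity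
open Literature.Barriers.NavierStokesRegularity.Scheffer TopologicalSpace

/-! ### Generic: power gauges from scale-invariant ball bounds -/

section Gauges

variable {U : ℝ → EuclideanSpace ℝ (Fin 3) → EuclideanSpace ℝ (Fin 3)}
  {H : ℝ → EuclideanSpace ℝ (Fin 3) → EuclideanSpace ℝ (Fin 3) →L[ℝ] EuclideanSpace ℝ (Fin 3)}
  {q : ℝ → EuclideanSpace ℝ (Fin 3) → ℝ} {C ρ : ℝ}

/-- `r^{2ρ} A(r; z₀) ≤ C` from the slice bound `∫_{B(x',r)} |U(s)|² ≤ C r^{1-2ρ}`. [folklore] -/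
theorem powerGaugeA_le_of_ball_bound
    (hC : ∀ (s : ℝ) (x' : EuclideanSpace ℝ (Fin 3)) (r : ℝ), 0 < r →
      ∫⁻ y in ball x' r, ‖U s y‖ₑ ^ 2 ≤ ENNReal.ofReal (C * r ^ (1 - 2 * ρ)))
    (z₀ : ℝ × EuclideanSpace ℝ (Fin 3)) {r : ℝ} (hr : 0 < r) :
    ENNReal.ofReal (r ^ (2 * ρ)) * cknA r z₀ U ≤ ENNReal.ofReal C := by
  have hsup : cknA r z₀ U ≤ (ENNReal.ofReal r)⁻¹ * ENNReal.ofReal (C * r ^ (1 - 2 * ρ)) :=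
    iSup₂_le fun t _ => mul_le_mul' le_rfl (hC t z₀.2 r hr)
  calc ENNReal.ofReal (r ^ (2 * ρ)) * cknA r z₀ U
      ≤ ENNReal.ofReal (r ^ (2 * ρ)) * ((ENNReal.ofReal r)⁻¹ * ENNReal.ofReal (C * r ^ (1 - 2 * ρ))) :=
        mul_le_mul' le_rfl hsup
    _ = ENNReal.ofReal (r ^ (2 * ρ) * (r⁻¹ * (C * r ^ (1 - 2 * ρ)))) := by
        rw [← ENNReal.ofReal_inv_of_pos hr, ← ENNReal.ofReal_mul (inv_pos.2 hr).le,
          ← ENNReal.ofReal_mul (by positivity)]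
    _ = ENNReal.ofReal C := by
        congr 1
        rw [show r ^ (2 * ρ) * (r⁻¹ * (C * r ^ (1 - 2 * ρ))) = C * (r ^ (2 * ρ) * r ^ (1 - 2 * ρ) * r⁻¹)
          by ring, ← Real.rpow_add hr, ← Real.rpow_neg_one, ← Real.rpow_add hr]
        norm_num

/-- `r^{ρ} E(r; z₀) ≤ C` from the cylinder bound `∫∫_{ℝ × B(x',r)} |H|² ≤ C r^{1-ρ}`. [folklore] -/
theorem powerGaugeE_le_of_cylinder_bound
    (hC : ∀ (x' : EuclideanSpace ℝ (Fin 3)) (r : ℝ), 0 < r →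
      ∫⁻ w in (univ : Set ℝ) ×ˢ ball x' r, ENNReal.ofReal (frobeniusNormSq (H w.1 w.2)) ≤
        ENNReal.ofReal (C * r ^ (1 - ρ)))
    (z₀ : ℝ × EuclideanSpace ℝ (Fin 3)) {r : ℝ} (hr : 0 < r) :
    ENNReal.ofReal (r ^ ρ) * cknE r z₀ H ≤ ENNReal.ofReal C := by
  have hcyl : ∫⁻ w in parabolicCylinder r z₀, ENNReal.ofReal (frobeniusNormSq (H w.1 w.2)) ≤
      ENNReal.ofReal (C * r ^ (1 - ρ)) :=
    (lintegral_mono_set (prod_mono (subset_univ _) Subset.rfl)).trans (hC z₀.2 r hr)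
  calc ENNReal.ofReal (r ^ ρ) * cknE r z₀ H
      ≤ ENNReal.ofReal (r ^ ρ) * ((ENNReal.ofReal r)⁻¹ * ENNReal.ofReal (C * r ^ (1 - ρ))) :=
        mul_le_mul' le_rfl (mul_le_mul' le_rfl hcyl)
    _ = ENNReal.ofReal (r ^ ρ * (r⁻¹ * (C * r ^ (1 - ρ)))) := by
        rw [← ENNReal.ofReal_inv_of_pos hr, ← ENNReal.ofReal_mul (inv_pos.2 hr).le,
          ← ENNReal.ofReal_mul (by positivity)]
    _ = ENNReal.ofReal C := by
        congr 1
        rw [show r ^ ρ * (r⁻¹ * (C * r ^ (1 - ρ))) = C * (r ^ ρ * r ^ (1 - ρ) * r⁻¹) by ring,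
          ← Real.rpow_add hr, ← Real.rpow_neg_one, ← Real.rpow_add hr]
        norm_num

/-- `r^{2ρ} D(r; z₀) ≤ C` from the cylinder bound `∫∫_{ℝ × B(x',r)} |q|^{3/2} ≤ C r^{2-2ρ}`.
[folklore] -/
theorem powerGaugeD_le_of_cylinder_bound
    (hC : ∀ (x' : EuclideanSpace ℝ (Fin 3)) (r : ℝ), 0 < r →
      ∫⁻ w in (univ : Set ℝ) ×ˢ ball x' r, ‖q w.1 w.2‖ₑ ^ (3 / 2 : ℝ) ≤
        ENNReal.ofReal (C * r ^ (2 - 2 * ρ)))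
    (z₀ : ℝ × EuclideanSpace ℝ (Fin 3)) {r : ℝ} (hr : 0 < r) :
    ENNReal.ofReal (r ^ (2 * ρ)) * cknD r z₀ q ≤ ENNReal.ofReal C := by
  have hcyl : ∫⁻ w in parabolicCylinder r z₀, ‖q w.1 w.2‖ₑ ^ (3 / 2 : ℝ) ≤
      ENNReal.ofReal (C * r ^ (2 - 2 * ρ)) :=
    (lintegral_mono_set (prod_mono (subset_univ _) Subset.rfl)).trans (hC z₀.2 r hr)
  calc ENNReal.ofReal (r ^ (2 * ρ)) * cknD r z₀ q
      ≤ ENNReal.ofReal (r ^ (2 * ρ)) *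
          ((ENNReal.ofReal r ^ 2)⁻¹ * ENNReal.ofReal (C * r ^ (2 - 2 * ρ))) :=
        mul_le_mul' le_rfl (mul_le_mul' le_rfl hcyl)
    _ = ENNReal.ofReal (r ^ (2 * ρ) * ((r ^ 2)⁻¹ * (C * r ^ (2 - 2 * ρ)))) := by
        rw [← ENNReal.ofReal_pow hr.le, ← ENNReal.ofReal_inv_of_pos (pow_pos hr 2),
          ← ENNReal.ofReal_mul (inv_pos.2 (pow_pos hr 2)).le, ← ENNReal.ofReal_mul (by positivity)]
    _ = ENNReal.ofReal C := by
        congr 1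
        rw [show r ^ (2 * ρ) * ((r ^ 2)⁻¹ * (C * r ^ (2 - 2 * ρ))) =
            C * (r ^ (2 * ρ) * r ^ (2 - 2 * ρ) * (r ^ 2)⁻¹) by ring, ← Real.rpow_add hr,
          show 2 * ρ + (2 - 2 * ρ) = ((2 : ℕ) : ℝ) by push_cast; ring, Real.rpow_natCast,
          mul_inv_cancel₀ (pow_ne_zero 2 hr.ne'), mul_one]

end Gauges

namespace IsSuperBlock

variable {T ν₀ τ σ a : ℝ} {z : EuclideanSpace ℝ (Fin 3)} {G : Set (EuclideanSpace ℝ (Fin 3))}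
  {u : ℝ → EuclideanSpace ℝ (Fin 3) → EuclideanSpace ℝ (Fin 3)} {ρ : ℝ}
  {U : ℝ → EuclideanSpace ℝ (Fin 3) → EuclideanSpace ℝ (Fin 3)}

/-! ### The three scale-invariant ball bounds of `𝔘` -/

/-- **`∫_{B(x',r)} |𝔘(s)|² ≤ C r^{1-2ρ}` for every slice `s ∈ ℝ`, centre and radius**: on its
window the slice is `a^{-n} 𝔲(t) ∘ (x₀ + τⁿ·)`, and the bound of
`exists_lintegral_ball_norm_sq_glueG_le` is invariant under the Euler scaling
(`window_scaling_A`). [folklore] -/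
theorem ancient_lintegral_ball_norm_sq_le (h : IsSuperBlock T ν₀ τ σ a z G u)
    (hρ : a = τ ^ (-(1 + ρ)))
    (hU : ∀ (n : ℕ) (s : ℝ), -blowupTime T σ ≤ σ ^ (2 * n) * s →
      U s = ((a⁻¹) ^ n • stPull (σ ^ (2 * n)) (τ ^ n) (blowupTime T σ) (blowupPoint τ z)
        (glueG T σ τ a z u)) s) :
    ∃ C : ℝ, 0 ≤ C ∧ ∀ (s : ℝ) (x' : EuclideanSpace ℝ (Fin 3)) (r : ℝ), 0 < r →
      ∫⁻ y in ball x' r, ‖U s y‖ₑ ^ 2 ≤ ENNReal.ofReal (C * r ^ (1 - 2 * ρ)) := by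
  obtain ⟨C, hC0, hC⟩ := h.exists_lintegral_ball_norm_sq_glueG_le hρ
  refine ⟨C, hC0, fun s x' r hr => ?_⟩
  obtain ⟨n, hn⟩ := h.exists_window_index s
  have hτn : 0 < τ ^ n := pow_pos h.τ_pos n
  have hαn : 0 < (a⁻¹) ^ n := pow_pos (inv_pos.2 h.gain_pos) n
  set t : ℝ := blowupTime T σ + σ ^ (2 * n) * s with htdef
  set F : EuclideanSpace ℝ (Fin 3) → ℝ≥0∞ := fun x => ‖glueG T σ τ a z u t x‖ₑ ^ 2 with hF
  have e1 : ∀ y, ‖U s y‖ₑ ^ 2 =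
      ENNReal.ofReal (((a⁻¹) ^ n) ^ 2) * F (blowupPoint τ z + τ ^ n • y) := by
    intro y
    rw [hU n s hn.le, smul_stPull_apply, enorm_smul, mul_pow, Real.enorm_eq_ofReal hαn.le,
      ENNReal.ofReal_pow hαn.le]
  simp_rw [e1]
  rw [lintegral_const_mul' _ _ ENNReal.ofReal_ne_top,
    ← preimage_space_affine_ball' hτn (blowupPoint τ z) x' r,
    setLIntegral_preimage_comp_space_affine hτn (blowupPoint τ z) F, finrank_euclideanSpace_fin]
  calc ENNReal.ofReal (((a⁻¹) ^ n) ^ 2) * (ENNReal.ofReal ((τ ^ n) ^ 3)⁻¹ *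
        ∫⁻ x in ball (blowupPoint τ z + τ ^ n • x') (τ ^ n * r), F x)
      ≤ ENNReal.ofReal (((a⁻¹) ^ n) ^ 2) * (ENNReal.ofReal ((τ ^ n) ^ 3)⁻¹ *
          ENNReal.ofReal (C * (τ ^ n * r) ^ (1 - 2 * ρ))) :=
        mul_le_mul' le_rfl (mul_le_mul' le_rfl (hC t _ _ (mul_pos hτn hr)))
    _ = ENNReal.ofReal (((a⁻¹) ^ n) ^ 2 * (((τ ^ n) ^ 3)⁻¹ * (C * (τ ^ n * r) ^ (1 - 2 * ρ)))) := by
        rw [← ENNReal.ofReal_mul (by positivity), ← ENNReal.ofReal_mul (by positivity)]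
    _ = ENNReal.ofReal (C * r ^ (1 - 2 * ρ)) := by
        congr 1
        rw [Real.mul_rpow hτn.le hr.le,
          show ((a⁻¹) ^ n) ^ 2 * (((τ ^ n) ^ 3)⁻¹ * (C * ((τ ^ n) ^ (1 - 2 * ρ) * r ^ (1 - 2 * ρ)))) =
            C * r ^ (1 - 2 * ρ) * (((a⁻¹) ^ n) ^ 2 * ((τ ^ n) ^ 3)⁻¹ * (τ ^ n) ^ (1 - 2 * ρ)) by ring,
          h.window_scaling_A hρ n, mul_one]

/-- **`∫∫_{ℝ × B(x',r)} |D𝔘|² ≤ C r^{1-ρ}`**: the time line is exhausted by the increasing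
windows; on the `n`-th window `D𝔘 = a^{-n}τⁿ D𝔲 ∘ Φ_n`, and the change of variables
`ds dy = (σ^{2n}τ^{3n})⁻¹ dt dx` turns the bound of `exists_lintegral_cylinder_frobeniusNormSq_le`
on `ℝ × B(x₀ + τⁿx', τⁿr)` into the same bound on `ℝ × B(x', r)` (`window_scaling_E`); monotone
convergence in `n`. [folklore] -/
theorem ancient_lintegral_cylinder_frobeniusNormSq_le (h : IsSuperBlock T ν₀ τ σ a z G u)
    (hρ : a = τ ^ (-(1 + ρ)))
    (hU : ∀ (n : ℕ) (s : ℝ), -blowupTime T σ ≤ σ ^ (2 * n) * s →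
      U s = ((a⁻¹) ^ n • stPull (σ ^ (2 * n)) (τ ^ n) (blowupTime T σ) (blowupPoint τ z)
        (glueG T σ τ a z u)) s) :
    ∃ C : ℝ, 0 ≤ C ∧ ∀ (x' : EuclideanSpace ℝ (Fin 3)) (r : ℝ), 0 < r →
      ∫⁻ w in (univ : Set ℝ) ×ˢ ball x' r, ENNReal.ofReal (frobeniusNormSq (fderiv ℝ (U w.1) w.2)) ≤
        ENNReal.ofReal (C * r ^ (1 - ρ)) := by
  obtain ⟨C, hC0, hC⟩ := h.exists_lintegral_cylinder_frobeniusNormSq_le hρ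
  refine ⟨C, hC0, fun x' r hr => ?_⟩
  set V : ℕ → Set ℝ := fun n => {s | -blowupTime T σ < σ ^ (2 * n) * s} with hV
  have hcover : (univ : Set ℝ) ×ˢ ball x' r = ⋃ n, V n ×ˢ ball x' r := by
    rw [← iUnion_prod_const]
    congr 1
    ext s
    simp only [mem_univ, mem_iUnion, hV, mem_setOf_eq, true_iff]
    exact h.exists_window_index s
  have hdir : Directed (· ⊆ ·) fun n => V n ×ˢ ball x' r :=
    (monotone_nat_of_le_succ fun n => Set.prod_mono (fun s hs => h.window_succ hs) Subset.rfl).directed_le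
  rw [hcover, setLIntegral_iUnion_of_directed _ hdir]
  refine iSup_le fun n => ?_
  have hτn : 0 < τ ^ n := pow_pos h.τ_pos n
  have hβn : 0 < σ ^ (2 * n) := pow_pos h.σ_pos _
  set F : ℝ × EuclideanSpace ℝ (Fin 3) → ℝ≥0∞ := fun w =>
    ENNReal.ofReal (frobeniusNormSq (fderiv ℝ (glueG T σ τ a z u w.1) w.2)) with hF
  have hmeas : MeasurableSet (V n ×ˢ ball x' r) :=
    (measurableSet_lt measurable_const (measurable_id.const_mul _)).prod measurableSet_ball
  have e1 : ∀ w ∈ V n ×ˢ ball x' r, ENNReal.ofReal (frobeniusNormSq (fderiv ℝ (U w.1) w.2)) =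
      ENNReal.ofReal (((a⁻¹) ^ n * τ ^ n) ^ 2) *
        F (stAffine (σ ^ (2 * n)) (τ ^ n) (blowupTime T σ) (blowupPoint τ z) w) := by
    intro w hw
    rw [h.ancient_fderiv_slice hU (le_of_lt hw.1), frobeniusNormSq_smul,
      ENNReal.ofReal_mul (sq_nonneg _), hF]
    simp only [stAffine_fst, stAffine_snd]
  calc ∫⁻ w in V n ×ˢ ball x' r, ENNReal.ofReal (frobeniusNormSq (fderiv ℝ (U w.1) w.2))
      = ∫⁻ w in V n ×ˢ ball x' r, ENNReal.ofReal (((a⁻¹) ^ n * τ ^ n) ^ 2) *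
          F (stAffine (σ ^ (2 * n)) (τ ^ n) (blowupTime T σ) (blowupPoint τ z) w) :=
        setLIntegral_congr_fun hmeas e1
    _ ≤ ∫⁻ w in (univ : Set ℝ) ×ˢ ball x' r, ENNReal.ofReal (((a⁻¹) ^ n * τ ^ n) ^ 2) *
          F (stAffine (σ ^ (2 * n)) (τ ^ n) (blowupTime T σ) (blowupPoint τ z) w) :=
        lintegral_mono_set (prod_mono (subset_univ _) Subset.rfl)
    _ = ENNReal.ofReal (((a⁻¹) ^ n * τ ^ n) ^ 2) * (ENNReal.ofReal (σ ^ (2 * n) * (τ ^ n) ^ 3)⁻¹ *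
          ∫⁻ w in (univ : Set ℝ) ×ˢ ball (blowupPoint τ z + τ ^ n • x') (τ ^ n * r), F w) := by
        rw [lintegral_const_mul' _ _ ENNReal.ofReal_ne_top,
          ← preimage_stAffine_univ_prod_ball (σ ^ (2 * n)) hτn (blowupTime T σ) (blowupPoint τ z) x' r,
          setLIntegral_preimage_comp_stAffine hβn hτn _ _ F, finrank_euclideanSpace_fin]
    _ ≤ ENNReal.ofReal (((a⁻¹) ^ n * τ ^ n) ^ 2) * (ENNReal.ofReal (σ ^ (2 * n) * (τ ^ n) ^ 3)⁻¹ *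
          ENNReal.ofReal (C * (τ ^ n * r) ^ (1 - ρ))) :=
        mul_le_mul' le_rfl (mul_le_mul' le_rfl (hC _ _ (mul_pos hτn hr)))
    _ = ENNReal.ofReal (((a⁻¹) ^ n * τ ^ n) ^ 2 * ((σ ^ (2 * n) * (τ ^ n) ^ 3)⁻¹ *
          (C * (τ ^ n * r) ^ (1 - ρ)))) := by
        rw [← ENNReal.ofReal_mul (by positivity), ← ENNReal.ofReal_mul (by positivity)]
    _ = ENNReal.ofReal (C * r ^ (1 - ρ)) := by
        congr 1
        rw [Real.mul_rpow hτn.le hr.le,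
          show ((a⁻¹) ^ n * τ ^ n) ^ 2 * ((σ ^ (2 * n) * (τ ^ n) ^ 3)⁻¹ *
              (C * ((τ ^ n) ^ (1 - ρ) * r ^ (1 - ρ)))) =
            C * r ^ (1 - ρ) * (((a⁻¹) ^ n * τ ^ n) ^ 2 * (σ ^ (2 * n) * (τ ^ n) ^ 3)⁻¹ *
              (τ ^ n) ^ (1 - ρ)) by ring,
          h.window_scaling_E hρ n, mul_one]

/-- **`∫∫_{ℝ × B(x',r)} |p̃[𝔘]|^{3/2} ≤ C r^{2-2ρ}`**: as for the dissipation, with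
`p̃[𝔘(s)] = a^{-2n} p̃[𝔲(t)] ∘ (x₀ + τⁿ·)` on the `n`-th window (`ancient_pressure_slice`),
`exists_lintegral_cylinder_pressure_le` and `window_scaling_D`. [folklore] -/
theorem ancient_lintegral_cylinder_pressure_le (h : IsSuperBlock T ν₀ τ σ a z G u)
    (hρ : a = τ ^ (-(1 + ρ)))
    (hU : ∀ (n : ℕ) (s : ℝ), -blowupTime T σ ≤ σ ^ (2 * n) * s →
      U s = ((a⁻¹) ^ n • stPull (σ ^ (2 * n)) (τ ^ n) (blowupTime T σ) (blowupPoint τ z)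
        (glueG T σ τ a z u)) s) :
    ∃ C : ℝ, 0 ≤ C ∧ ∀ (x' : EuclideanSpace ℝ (Fin 3)) (r : ℝ), 0 < r →
      ∫⁻ w in (univ : Set ℝ) ×ˢ ball x' r, ‖normalisedPressure (U w.1) w.2‖ₑ ^ (3 / 2 : ℝ) ≤
        ENNReal.ofReal (C * r ^ (2 - 2 * ρ)) := by
  obtain ⟨C, hC0, hC⟩ := h.exists_lintegral_cylinder_pressure_le hρ
  refine ⟨C, hC0, fun x' r hr => ?_⟩
  set V : ℕ → Set ℝ := fun n => {s | -blowupTime T σ < σ ^ (2 * n) * s} with hV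
  have hcover : (univ : Set ℝ) ×ˢ ball x' r = ⋃ n, V n ×ˢ ball x' r := by
    rw [← iUnion_prod_const]
    congr 1
    ext s
    simp only [mem_univ, mem_iUnion, hV, mem_setOf_eq, true_iff]
    exact h.exists_window_index s
  have hdir : Directed (· ⊆ ·) fun n => V n ×ˢ ball x' r :=
    (monotone_nat_of_le_succ fun n => Set.prod_mono (fun s hs => h.window_succ hs) Subset.rfl).directed_le
  rw [hcover, setLIntegral_iUnion_of_directed _ hdir]
  refine iSup_le fun n => ?_
  have hτn : 0 < τ ^ n := pow_pos h.τ_pos n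
  have hβn : 0 < σ ^ (2 * n) := pow_pos h.σ_pos _
  have hα2 : 0 ≤ ((a⁻¹) ^ n) ^ 2 := sq_nonneg _
  set F : ℝ × EuclideanSpace ℝ (Fin 3) → ℝ≥0∞ := fun w =>
    ‖normalisedPressure (glueG T σ τ a z u w.1) w.2‖ₑ ^ (3 / 2 : ℝ) with hF
  have hmeas : MeasurableSet (V n ×ˢ ball x' r) :=
    (measurableSet_lt measurable_const (measurable_id.const_mul _)).prod measurableSet_ball
  have e1 : ∀ w ∈ V n ×ˢ ball x' r, ‖normalisedPressure (U w.1) w.2‖ₑ ^ (3 / 2 : ℝ) =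
      ENNReal.ofReal ((((a⁻¹) ^ n) ^ 2) ^ (3 / 2 : ℝ)) *
        F (stAffine (σ ^ (2 * n)) (τ ^ n) (blowupTime T σ) (blowupPoint τ z) w) := by
    intro w hw
    rw [h.ancient_pressure_slice hU (le_of_lt hw.1)]
    simp only [hF, stAffine_fst, stAffine_snd]
    rw [enorm_mul, ENNReal.mul_rpow_of_nonneg _ _ (by norm_num : (0 : ℝ) ≤ 3 / 2),
      Real.enorm_eq_ofReal hα2, ENNReal.ofReal_rpow_of_nonneg hα2 (by norm_num : (0 : ℝ) ≤ 3 / 2)]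
  calc ∫⁻ w in V n ×ˢ ball x' r, ‖normalisedPressure (U w.1) w.2‖ₑ ^ (3 / 2 : ℝ)
      = ∫⁻ w in V n ×ˢ ball x' r, ENNReal.ofReal ((((a⁻¹) ^ n) ^ 2) ^ (3 / 2 : ℝ)) *
          F (stAffine (σ ^ (2 * n)) (τ ^ n) (blowupTime T σ) (blowupPoint τ z) w) :=
        setLIntegral_congr_fun hmeas e1
    _ ≤ ∫⁻ w in (univ : Set ℝ) ×ˢ ball x' r, ENNReal.ofReal ((((a⁻¹) ^ n) ^ 2) ^ (3 / 2 : ℝ)) *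
          F (stAffine (σ ^ (2 * n)) (τ ^ n) (blowupTime T σ) (blowupPoint τ z) w) :=
        lintegral_mono_set (prod_mono (subset_univ _) Subset.rfl)
    _ = ENNReal.ofReal ((((a⁻¹) ^ n) ^ 2) ^ (3 / 2 : ℝ)) *
          (ENNReal.ofReal (σ ^ (2 * n) * (τ ^ n) ^ 3)⁻¹ *
          ∫⁻ w in (univ : Set ℝ) ×ˢ ball (blowupPoint τ z + τ ^ n • x') (τ ^ n * r), F w) := by
        rw [lintegral_const_mul' _ _ ENNReal.ofReal_ne_top,
          ← preimage_stAffine_univ_prod_ball (σ ^ (2 * n)) hτn (blowupTime T σ) (blowupPoint τ z) x' r,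
          setLIntegral_preimage_comp_stAffine hβn hτn _ _ F, finrank_euclideanSpace_fin]
    _ ≤ ENNReal.ofReal ((((a⁻¹) ^ n) ^ 2) ^ (3 / 2 : ℝ)) *
          (ENNReal.ofReal (σ ^ (2 * n) * (τ ^ n) ^ 3)⁻¹ * ENNReal.ofReal (C * (τ ^ n * r) ^ (2 - 2 * ρ))) :=
        mul_le_mul' le_rfl (mul_le_mul' le_rfl (hC _ _ (mul_pos hτn hr)))
    _ = ENNReal.ofReal ((((a⁻¹) ^ n) ^ 2) ^ (3 / 2 : ℝ) * ((σ ^ (2 * n) * (τ ^ n) ^ 3)⁻¹ *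
          (C * (τ ^ n * r) ^ (2 - 2 * ρ)))) := by
        rw [← ENNReal.ofReal_mul (by positivity), ← ENNReal.ofReal_mul (by positivity)]
    _ = ENNReal.ofReal (C * r ^ (2 - 2 * ρ)) := by
        congr 1
        rw [Real.mul_rpow hτn.le hr.le,
          show (((a⁻¹) ^ n) ^ 2) ^ (3 / 2 : ℝ) * ((σ ^ (2 * n) * (τ ^ n) ^ 3)⁻¹ *
              (C * ((τ ^ n) ^ (2 - 2 * ρ) * r ^ (2 - 2 * ρ)))) =
            C * r ^ (2 - 2 * ρ) * ((((a⁻¹) ^ n) ^ 2) ^ (3 / 2 : ℝ) * (σ ^ (2 * n) * (τ ^ n) ^ 3)⁻¹ *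
              (τ ^ n) ^ (2 - 2 * ρ)) by ring,
          h.window_scaling_D hρ n, mul_one]

/-! ### Seregin's power gauges of `𝔘`: every centre, every scale -/

/-- **(1.7) for the ancient cascade at every centre and EVERY scale**: there is `M ≥ 0` with
`r^{2ρ} A(r; z₀) + r^{ρ} E(r; z₀) + r^{2ρ} D(r; z₀) ≤ M` for `𝔘`, its slice derivative and its
pressure `p̃[𝔘]`, for all `z₀ ∈ ℝ × ℝ³` and all `r > 0` — in particular the gauge hypothesis of
`PowerGaugeEulerLiouville` (`z₀ = 0`, all `a > 0`). [folklore] -/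
theorem ancient_powerGauges_le (h : IsSuperBlock T ν₀ τ σ a z G u) (hρ : a = τ ^ (-(1 + ρ)))
    (hU : ∀ (n : ℕ) (s : ℝ), -blowupTime T σ ≤ σ ^ (2 * n) * s →
      U s = ((a⁻¹) ^ n • stPull (σ ^ (2 * n)) (τ ^ n) (blowupTime T σ) (blowupPoint τ z)
        (glueG T σ τ a z u)) s) :
    ∃ M : ℝ, 0 ≤ M ∧ ∀ (z₀ : ℝ × EuclideanSpace ℝ (Fin 3)) (r : ℝ), 0 < r →
      ENNReal.ofReal (r ^ (2 * ρ)) * cknA r z₀ U +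
        ENNReal.ofReal (r ^ ρ) * cknE r z₀ (fun s y => fderiv ℝ (U s) y) +
        ENNReal.ofReal (r ^ (2 * ρ)) * cknD r z₀ (fun s => normalisedPressure (U s)) ≤
      ENNReal.ofReal M := by
  obtain ⟨CA, hCA0, hCA⟩ := h.ancient_lintegral_ball_norm_sq_le hρ hU
  obtain ⟨CE, hCE0, hCE⟩ := h.ancient_lintegral_cylinder_frobeniusNormSq_le hρ hU
  obtain ⟨CD, hCD0, hCD⟩ := h.ancient_lintegral_cylinder_pressure_le hρ hU
  refine ⟨CA + CE + CD, by positivity, fun z₀ r hr => ?_⟩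
  rw [ENNReal.ofReal_add (add_nonneg hCA0 hCE0) hCD0, ENNReal.ofReal_add hCA0 hCE0]
  exact add_le_add (add_le_add (powerGaugeA_le_of_ball_bound hCA z₀ hr)
    (powerGaugeE_le_of_cylinder_bound (H := fun s y => fderiv ℝ (U s) y) hCE z₀ hr))
    (powerGaugeD_le_of_cylinder_bound (q := fun s => normalisedPressure (U s)) hCD z₀ hr)

/-- The gauge hypothesis of `PowerGaugeEulerLiouville` for `𝔘`, verbatim: some `c : ℝ≥0` bounds
`a^{2ρ} A(a; 0) + a^{ρ} E(a; 0) + a^{2ρ} D(a; 0)` for ALL `a > 0`. [folklore] -/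
theorem ancient_powerGauges_le_nnreal (h : IsSuperBlock T ν₀ τ σ a z G u) (hρ : a = τ ^ (-(1 + ρ)))
    (hU : ∀ (n : ℕ) (s : ℝ), -blowupTime T σ ≤ σ ^ (2 * n) * s →
      U s = ((a⁻¹) ^ n • stPull (σ ^ (2 * n)) (τ ^ n) (blowupTime T σ) (blowupPoint τ z)
        (glueG T σ τ a z u)) s) :
    ∃ c : ℝ≥0, ∀ r : ℝ, 0 < r →
      ENNReal.ofReal (r ^ (2 * ρ)) * cknA r (0 : ℝ × EuclideanSpace ℝ (Fin 3)) U +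
        ENNReal.ofReal (r ^ ρ) * cknE r (0 : ℝ × EuclideanSpace ℝ (Fin 3)) (fun s y => fderiv ℝ (U s) y) +
        ENNReal.ofReal (r ^ (2 * ρ)) *
          cknD r (0 : ℝ × EuclideanSpace ℝ (Fin 3)) (fun s => normalisedPressure (U s)) ≤ (c : ℝ≥0∞) := by
  obtain ⟨M, -, hM⟩ := h.ancient_powerGauges_le hρ hU
  exact ⟨Real.toNNReal M, fun r hr => hM 0 r hr⟩

end IsSuperBlock

end Summit.NavierStokesRegularity.NavierStokesRegularity.Theorems.TypeIliouvilleNoTypeIINegative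

end
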